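import Literature.AlgebraicTopology.CharacteristicClasses.TopologicalChernClasses
import Literature.AlgebraicTopology.SingularHomology.CupProductProofs
import HarnessLib

/-!
# Additivity of the Newton power sums and of the Chern character under Whitney sum

Topic `Literature/AlgebraicTopology/CharacteristicClasses`. F. Hirzebruch, *Topological Methods in
Algebraic Geometry* (3rd ed. 1966), §10.1: with the power sums `s_k = Σᵢ γᵢᵏ` of the Chern roots,
related to the Chern classes by Newton's formulae, "`ch(ξ ⊕ η) = ch(ξ) + ch(η)`" — the Chern
character `ch_k = s_k / k!` is ADDITIVE under Whitney sum. The companion file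
`TopologicalChernClasses` defines `newtonPowerSum` by Newton's recursion and the topological Chern
character `ChernClassTheory.topologicalChernCharacter`, and records that additivity "is a theorem
about symmetric functions plus (C₂)" left unproved there. This file proves it.

## The argument (generating functions, in the even cohomology ring)

On families `x = (x_n)_n`, `x_n ∈ H²ⁿ(X; R)`, the cup product induces the convolution
`(x ⋆ y)_n = Σ_{i+j=n} x_i ⌣ y_j` (`evenConv`; this is the product of the completed even cohomology
ring `Π_n H²ⁿ(X; R)`, commutative and associative because even-degree classes commute — Hatcher
Thm. 3.11, the tree's `cupProduct_gradedComm_holds` — and the cup product is associative). The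
Whitney formula (C₂) says precisely `c(ξ ⊕ η) = c(ξ) ⋆ c(η)`. The Euler operator
`(D x)_n = n x_n` is a derivation of `⋆` (`euler_evenConv`). Newton's recursion for the power sums
`s_k(c)` of a family `c` with `c₀ = 1` is equivalent to the single identity
`c ⋆ q(c) = D c`, where `q(c)_k = (-1)ᵏ⁻¹ s_k(c)` (`k ≥ 1`, `q₀ = 0`) — the coefficientwise form of
`Σ_{k ≥ 1} (-1)ᵏ⁻¹ s_k tᵏ = t C'(t)/C(t)` (`evenConv_signedPowerSum`) — and this identity has at
most one solution `q` (`eq_of_evenConv_eq`, since `c₀ = 1`). For `c = a ⋆ b`, Leibniz gives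
`(a ⋆ b) ⋆ (q(a) + q(b)) = b ⋆ (D a) + a ⋆ (D b) = D (a ⋆ b)`, hence `q(a ⋆ b) = q(a) + q(b)`:
the power sums, and with them `ch_k = s_k / k!`, are additive (`newtonPowerSum_whitney`,
`ChernClassTheory.chernPowerSum_directSum`, `ChernClassTheory.topologicalChernCharacter_directSum`).

## References

* [Hirzebruch1966] F. Hirzebruch, *Topological Methods in Algebraic Geometry*, 3rd ed. (1966),
  §10.1 (Chern character, Newton formulae, additivity).
* [HusemollerFibreBundles1994] D. Husemoller, *Fibre Bundles*, 3rd ed. (1994), Ch. 17 §3 (C₂),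
  Ch. 20 §8 (the Chern character is additive).
* [HatcherAT2002] A. Hatcher, *Algebraic Topology* (2002), §3.2, Thm. 3.11.
-/

noncomputable section

universe u v

namespace Literature.AlgebraicTopology.CharacteristicClasses

open Literature.AlgebraicTopology.SingularHomology

section Algebra

variable {X : Type u} [TopologicalSpace X] {R : Type v} [CommRing R]

/-! ### Cup products of even classes into a prescribed degree -/

/-- The cup product `H²ⁱ × H²ʲ → H²ⁿ` when `i + j = n`, and `0` otherwise: the `(i, j)`-component of
the multiplication of the even cohomology ring `Π_n H²ⁿ(X; R)`, as a bilinear map whose type does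
not depend on the degree equation. [cite: HatcherAT2002, §3.2] -/
def cupInto (n i j : ℕ) :
    singularCohomology R R X (2 * i) →ₗ[R] singularCohomology R R X (2 * j) →ₗ[R]
      singularCohomology R R X (2 * n) :=
  if h : i + j = n then cupEven h else 0

/-- On the antidiagonal `cupInto` is the cup product. [cite: HatcherAT2002, §3.2] -/
theorem cupInto_of_eq {n i j : ℕ} (h : i + j = n) :
    (cupInto n i j : singularCohomology R R X (2 * i) →ₗ[R] _) = cupEven h :=
  dif_pos h

/-- Off the antidiagonal `cupInto` vanishes. [cite: HatcherAT2002, §3.2] -/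
theorem cupInto_of_ne {n i j : ℕ} (h : i + j ≠ n) :
    (cupInto n i j : singularCohomology R R X (2 * i) →ₗ[R] _) = 0 :=
  dif_neg h

/-- **Even-degree classes commute**: `a ⌣ b = b ⌣ a` for `a ∈ H²ⁱ`, `b ∈ H²ʲ` (graded
commutativity, Hatcher Thm. 3.11, with the even sign `(-1)^{2i·2j} = 1`). [cite: HatcherAT2002, Thm. 3.11] -/
theorem cupEven_comm {i j n : ℕ} (h : i + j = n) (h' : j + i = n) (a : singularCohomology R R X (2 * i))
    (b : singularCohomology R R X (2 * j)) : cupEven h a b = cupEven h' b a := by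
  have hc := cupProduct_gradedComm_holds R X (two_mul_add_two_mul h) (two_mul_add_two_mul h') a b
  have he : Even (2 * i * (2 * j)) := ⟨i * (2 * j), by ring⟩
  rw [he.neg_one_pow, one_smul] at hc
  exact hc

/-- `cupInto` is symmetric: `cupInto n i j a b = cupInto n j i b a`. [cite: HatcherAT2002, Thm. 3.11] -/
theorem cupInto_comm (n i j : ℕ) (a : singularCohomology R R X (2 * i))
    (b : singularCohomology R R X (2 * j)) : cupInto n i j a b = cupInto n j i b a := by
  by_cases h : i + j = n
  · rw [cupInto_of_eq h, cupInto_of_eq (by omega : j + i = n)]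
    exact cupEven_comm h _ a b
  · rw [cupInto_of_ne h, cupInto_of_ne (by omega : j + i ≠ n)]
    rfl

/-- Associativity of even cup products: `(a ⌣ b) ⌣ c = a ⌣ (b ⌣ c)` (Hatcher §3.2 p. 211).
[cite: HatcherAT2002, §3.2] -/
theorem cupEven_assoc {i j k m l s : ℕ} (hij : i + j = m) (hjk : j + k = l) (hm : m + k = s)
    (hs : i + l = s) (a : singularCohomology R R X (2 * i)) (b : singularCohomology R R X (2 * j))
    (c : singularCohomology R R X (2 * k)) :
    cupEven hm (cupEven hij a b) c = cupEven hs a (cupEven hjk b c) :=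
  cupProduct_assoc _ _ _ _ a b c

/-- Associativity of `cupInto` on the antidiagonal of triples. [cite: HatcherAT2002, §3.2] -/
theorem cupInto_assoc {i j k m l n : ℕ} (hij : i + j = m) (hjk : j + k = l) (hn : m + k = n)
    (a : singularCohomology R R X (2 * i)) (b : singularCohomology R R X (2 * j))
    (c : singularCohomology R R X (2 * k)) :
    cupInto n m k (cupInto m i j a b) c = cupInto n i l a (cupInto l j k b c) := by
  rw [cupInto_of_eq hij, cupInto_of_eq hjk, cupInto_of_eq hn, cupInto_of_eq (by omega : i + l = n)]
  exact cupEven_assoc hij hjk hn _ a b c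

/-- `1 ⌣ x = x` for the unit `1 ∈ H⁰ = H^{2·0}`. [cite: HatcherAT2002, §3.2 p. 211] -/
theorem cupInto_one_left (n : ℕ) (x : singularCohomology R R X (2 * n)) :
    cupInto n 0 n (singularCohomology.one R X) x = x := by
  rw [cupInto_of_eq (Nat.zero_add n)]
  exact one_cupProduct x

/-! ### The convolution product of the even cohomology ring and the Euler derivation -/

variable (X R) in
/-- A family of even classes `x = (x_n)_n`, `x_n ∈ H²ⁿ(X; R)`: an element of the (completed) even
cohomology ring `Π_n H²ⁿ(X; R)`, e.g. the total Chern class `c(ξ) = (cᵢ(ξ))ᵢ`. [cite: HatcherAT2002, §3.2] -/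
abbrev EvenFamily : Type _ := (n : ℕ) → singularCohomology R R X (2 * n)

/-- **The convolution product** `(x ⋆ y)_n = Σ_{i+j=n} x_i ⌣ y_j` of two families of even classes —
the multiplication of the even cohomology ring `Π_n H²ⁿ(X; R)`; the Whitney formula (C₂) reads
`c(ξ ⊕ η) = c(ξ) ⋆ c(η)`. [cite: HatcherAT2002, §3.2] [cite: HusemollerFibreBundles1994, Ch. 17 §3 (C₂)] -/
def evenConv (x y : EvenFamily X R) : EvenFamily X R :=
  fun n ↦ ∑ ij ∈ Finset.antidiagonal n, cupInto n ij.1 ij.2 (x ij.1) (y ij.2)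

/-- Unfolding the convolution product. [cite: HatcherAT2002, §3.2] -/
theorem evenConv_apply (x y : EvenFamily X R) (n : ℕ) :
    evenConv x y n = ∑ ij ∈ Finset.antidiagonal n, cupInto n ij.1 ij.2 (x ij.1) (y ij.2) := rfl

/-- The convolution product in the spelling of the Whitney formula (C₂): a sum over the points of
the antidiagonal of genuine cup products. [cite: HusemollerFibreBundles1994, Ch. 17 §3 (C₂)] -/
theorem evenConv_apply_eq_sum_cupEven (x y : EvenFamily X R) (n : ℕ) :
    evenConv x y n = ∑ ij : Finset.antidiagonal n,
      cupEven (Finset.mem_antidiagonal.mp ij.2) (x ij.1.1) (y ij.1.2) := by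
  rw [evenConv_apply, ← Finset.sum_coe_sort (Finset.antidiagonal n)]
  refine Finset.sum_congr rfl fun ij _ ↦ ?_
  rw [cupInto_of_eq (Finset.mem_antidiagonal.mp ij.2)]

/-- The convolution product is commutative (even classes commute). [cite: HatcherAT2002, Thm. 3.11] -/
theorem evenConv_comm (x y : EvenFamily X R) : evenConv x y = evenConv y x := by
  funext n
  rw [evenConv_apply, evenConv_apply, ← Finset.Nat.sum_antidiagonal_swap]
  exact Finset.sum_congr rfl fun ij _ ↦ cupInto_comm n _ _ _ _

/-- The convolution product is additive in the right factor. [cite: HatcherAT2002, §3.2] -/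
theorem evenConv_add (x y z : EvenFamily X R) : evenConv x (y + z) = evenConv x y + evenConv x z := by
  funext n
  simp only [evenConv_apply, Pi.add_apply, map_add, Finset.sum_add_distrib]

/-- The convolution product is additive in the left factor. [cite: HatcherAT2002, §3.2] -/
theorem add_evenConv (x y z : EvenFamily X R) : evenConv (x + y) z = evenConv x z + evenConv y z := by
  rw [evenConv_comm, evenConv_add, evenConv_comm z x, evenConv_comm z y]

/-- The convolution product is associative (associativity of the cup product and re-indexing of
the antidiagonal of triples). [cite: HatcherAT2002, §3.2] -/
theorem evenConv_assoc (x y z : EvenFamily X R) :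
    evenConv (evenConv x y) z = evenConv x (evenConv y z) := by
  funext n
  simp only [evenConv_apply, map_sum, LinearMap.sum_apply, Finset.sum_sigma']
  refine Finset.sum_nbij' (fun q ↦ ⟨(q.2.1, q.2.2 + q.1.2), (q.2.2, q.1.2)⟩)
    (fun q ↦ ⟨(q.1.1 + q.2.1, q.2.2), (q.1.1, q.2.1)⟩) ?_ ?_ ?_ ?_ ?_
  · rintro ⟨⟨m, k⟩, ⟨i, j⟩⟩ h
    simp only [Finset.mem_sigma, Finset.mem_antidiagonal] at h ⊢
    exact ⟨by omega, trivial⟩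
  · rintro ⟨⟨i, l⟩, ⟨j, k⟩⟩ h
    simp only [Finset.mem_sigma, Finset.mem_antidiagonal] at h ⊢
    exact ⟨by omega, trivial⟩
  · rintro ⟨⟨m, k⟩, ⟨i, j⟩⟩ h
    simp only [Finset.mem_sigma, Finset.mem_antidiagonal] at h
    obtain ⟨rfl, rfl⟩ := h
    rfl
  · rintro ⟨⟨i, l⟩, ⟨j, k⟩⟩ h
    simp only [Finset.mem_sigma, Finset.mem_antidiagonal] at h
    obtain ⟨rfl, rfl⟩ := h
    rfl
  · rintro ⟨⟨m, k⟩, ⟨i, j⟩⟩ h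
    simp only [Finset.mem_sigma, Finset.mem_antidiagonal] at h
    obtain ⟨rfl, rfl⟩ := h
    exact cupInto_assoc rfl rfl rfl _ _ _

/-- **The Euler operator** `(D x)_n = n · x_n` on families of even classes (the operator
`t d/dt` on `Σ x_n tⁿ`). [cite: Hirzebruch1966, §10.1] -/
def euler (x : EvenFamily X R) : EvenFamily X R := fun n ↦ (n : R) • x n

/-- Unfolding the Euler operator. [cite: Hirzebruch1966, §10.1] -/
@[simp]
theorem euler_apply (x : EvenFamily X R) (n : ℕ) : euler x n = (n : R) • x n := rfl

/-- **Leibniz rule**: the Euler operator is a derivation of the convolution product,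
`D(x ⋆ y) = D x ⋆ y + x ⋆ D y` (degrees add under `⌣`). [cite: Hirzebruch1966, §10.1] -/
theorem euler_evenConv (x y : EvenFamily X R) :
    euler (evenConv x y) = evenConv (euler x) y + evenConv x (euler y) := by
  funext n
  rw [Pi.add_apply, euler_apply, evenConv_apply, evenConv_apply, evenConv_apply, Finset.smul_sum,
    ← Finset.sum_add_distrib]
  rw [show (∑ ij ∈ Finset.antidiagonal n, (n : R) • cupInto n ij.1 ij.2 (x ij.1) (y ij.2)) =
      ∑ ij ∈ Finset.antidiagonal n, ((ij.1 + ij.2 : ℕ) : R) • cupInto n ij.1 ij.2 (x ij.1) (y ij.2) from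
    (Finset.Nat.sum_antidiagonal_subst
      (f := fun ij m ↦ ((m : ℕ) : R) • cupInto n ij.1 ij.2 (x ij.1) (y ij.2)))]
  refine Finset.sum_congr rfl fun ij _ ↦ ?_
  rw [euler_apply, euler_apply, map_smul, LinearMap.smul_apply, map_smul, Nat.cast_add, add_smul]

/-- **Uniqueness of solutions of `c ⋆ q = d`**: if `c₀ = 1` then `c ⋆ q = c ⋆ q'` forces `q = q'`
(the degree-`n` component of `c ⋆ q` is `q_n` plus terms in `q_m`, `m < n`). [cite: Hirzebruch1966, §10.1] -/
theorem eq_of_evenConv_eq {c q q' : EvenFamily X R} (hc : c 0 = singularCohomology.one R X)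
    (h : evenConv c q = evenConv c q') : q = q' := by
  funext n
  induction n using Nat.strongRec with
  | ind n ih =>
    have hn := congrFun h n
    cases n with
    | zero =>
      rw [evenConv_apply, evenConv_apply, Finset.Nat.antidiagonal_zero, Finset.sum_singleton,
        Finset.sum_singleton] at hn
      change cupInto 0 0 0 (c 0) (q 0) = cupInto 0 0 0 (c 0) (q' 0) at hn
      rwa [hc, cupInto_one_left, cupInto_one_left] at hn
    | succ k =>
      rw [evenConv_apply, evenConv_apply, Finset.Nat.sum_antidiagonal_succ,
        Finset.Nat.sum_antidiagonal_succ] at hn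
      dsimp only at hn
      rw [hc, cupInto_one_left, cupInto_one_left] at hn
      have hs : ∑ ij ∈ Finset.antidiagonal k, cupInto (k + 1) (ij.1 + 1) ij.2 (c (ij.1 + 1)) (q ij.2) =
          ∑ ij ∈ Finset.antidiagonal k, cupInto (k + 1) (ij.1 + 1) ij.2 (c (ij.1 + 1)) (q' ij.2) := by
        refine Finset.sum_congr rfl fun ij hij ↦ ?_
        rw [ih ij.2 (by have := Finset.mem_antidiagonal.mp hij; omega)]
      rw [hs] at hn
      exact add_right_cancel hn

/-! ### Newton's recursion as `c ⋆ q = D c` -/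

variable (X) in
/-- **The signed power sums** `q_k = (-1)ᵏ⁻¹ s_k(c)` (`k ≥ 1`), `q₀ = 0`, of a family `c` with rank
`r` — the coefficients of `t C'(t)/C(t) = Σ_{k ≥ 1} (-1)ᵏ⁻¹ s_k tᵏ` (for Chern roots `γᵢ`,
`C(t) = Π (1 + γᵢ t)` and `s_k = Σ γᵢᵏ`). The sign is written `(-1)ᵏ⁺¹`. [cite: Hirzebruch1966, §10.1] -/
def signedPowerSum (c : EvenFamily X R) (r : ℕ) : EvenFamily X R
  | 0 => 0
  | k + 1 => ((-1 : ℤ) ^ k) • newtonPowerSum X c r (k + 1)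

/-- `q₀ = 0`. [cite: Hirzebruch1966, §10.1] -/
@[simp]
theorem signedPowerSum_zero (c : EvenFamily X R) (r : ℕ) : signedPowerSum X c r 0 = 0 := rfl

/-- `q_{k+1} = (-1)ᵏ s_{k+1}`. [cite: Hirzebruch1966, §10.1] -/
theorem signedPowerSum_succ (c : EvenFamily X R) (r k : ℕ) :
    signedPowerSum X c r (k + 1) = ((-1 : ℤ) ^ k) • newtonPowerSum X c r (k + 1) := rfl

/-- `q_m = (-1)ᵐ⁺¹ s_m` for `0 < m`. [cite: Hirzebruch1966, §10.1] -/
theorem signedPowerSum_of_pos (c : EvenFamily X R) (r : ℕ) {m : ℕ} (hm : 0 < m) :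
    signedPowerSum X c r m = ((-1 : ℤ) ^ (m + 1)) • newtonPowerSum X c r m := by
  obtain ⟨k, rfl⟩ : ∃ k, m = k + 1 := ⟨m - 1, by omega⟩
  rw [signedPowerSum_succ, pow_succ, pow_succ, mul_assoc, neg_one_mul, neg_neg, mul_one]

/-- `s_{k+1} = (-1)ᵏ q_{k+1}`. [cite: Hirzebruch1966, §10.1] -/
theorem newtonPowerSum_succ_eq_smul_signedPowerSum (c : EvenFamily X R) (r k : ℕ) :
    newtonPowerSum X c r (k + 1) = ((-1 : ℤ) ^ k) • signedPowerSum X c r (k + 1) := by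
  rw [signedPowerSum_succ, smul_smul, ← pow_add, ← two_mul, (even_two_mul k).neg_one_pow, one_smul]

/-- Signs: `(-1)ᵃ = -(-1)ᵇ` when `a + b` is odd. [folklore] -/
private theorem neg_one_pow_eq_neg_of_odd {a b : ℕ} (h : Odd (a + b)) : ((-1 : ℤ) ^ a) = -((-1 : ℤ) ^ b) := by
  have hab : (-1 : ℤ) ^ (a + b) = -1 := h.neg_one_pow
  rw [pow_add] at hab
  have hb : ((-1 : ℤ) ^ b) * (-1) ^ b = 1 := by
    rw [← pow_add, ← two_mul]
    exact (even_two_mul b).neg_one_pow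
  linear_combination ((-1 : ℤ) ^ b) * hab - ((-1 : ℤ) ^ a) * hb

/-- **Newton's recursion in generating-function form**: for a family `c` with `c₀ = 1` and its
signed power sums `q`, `c ⋆ q = D c`, i.e. `Σ_{i+j=n} c_i ⌣ q_j = n c_n` — the coefficient of
`tⁿ` in `C(t) · (t C'(t)/C(t)) = t C'(t)`, equivalently Newton's formula
`s_n - c₁ s_{n-1} + ⋯ + (-1)ⁿ n c_n = 0`. [cite: Hirzebruch1966, §10.1] -/
theorem evenConv_signedPowerSum {c : EvenFamily X R} (hc : c 0 = singularCohomology.one R X) (r : ℕ) :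
    evenConv c (signedPowerSum X c r) = euler c := by
  funext n
  cases n with
  | zero =>
    rw [evenConv_apply, Finset.Nat.antidiagonal_zero, Finset.sum_singleton, euler_apply, Nat.cast_zero,
      zero_smul]
    change cupInto 0 0 0 (c 0) (signedPowerSum X c r 0) = 0
    rw [signedPowerSum_zero, map_zero]
  | succ k =>
    rw [evenConv_apply, Finset.Nat.sum_antidiagonal_succ, euler_apply]
    dsimp only
    rw [hc, cupInto_one_left, Finset.Nat.sum_antidiagonal_eq_sum_range_succ_mk, Finset.sum_range_succ,
      Nat.sub_self, signedPowerSum_zero, map_zero, add_zero, signedPowerSum_succ, newtonPowerSum_succ,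
      smul_add, smul_smul, ← mul_assoc, ← pow_add, ← two_mul, (even_two_mul k).neg_one_pow, one_mul,
      Finset.smul_sum, Finset.sum_range, add_assoc, ← Finset.sum_add_distrib]
    rw [Finset.sum_eq_zero fun (i : Fin k) _ ↦ ?_]
    · rw [add_zero, Nat.cast_smul_eq_nsmul ℤ, Nat.cast_smul_eq_nsmul R]
    · have hi := i.isLt
      rw [smul_smul, ← pow_add, cupInto_of_eq (by omega : ((i : ℕ) + 1) + (k - i) = k + 1),
        signedPowerSum_of_pos c r (by omega : 0 < k - (i : ℕ)), map_zsmul,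
        neg_one_pow_eq_neg_of_odd (a := k - (i : ℕ) + 1) (b := k + (i : ℕ)) ⟨k, by omega⟩, ← add_smul,
        add_neg_cancel, zero_smul]

/-- **Additivity of the Newton power sums under the Whitney formula**: if `a₀ = b₀ = 1` and
`c_m = Σ_{i+j=m} a_i ⌣ b_j` for all `m` (so `c = a ⋆ b`, the total Chern class of a Whitney sum by
(C₂)), then `s_k(c) = s_k(a) + s_k(b)` with ranks `r + r'` (for `k = 0`: `s₀ = rank`). Proof:
`q(a) + q(b)` solves `c ⋆ q = D c` by the Leibniz rule, and the solution is unique.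
[cite: Hirzebruch1966, §10.1] [cite: HusemollerFibreBundles1994, Ch. 20 §8] -/
theorem newtonPowerSum_whitney (a b c : EvenFamily X R) (ha : a 0 = singularCohomology.one R X)
    (hb : b 0 = singularCohomology.one R X)
    (hc : ∀ m, c m = ∑ ij : Finset.antidiagonal m, cupEven (Finset.mem_antidiagonal.mp ij.2) (a ij.1.1) (b ij.1.2))
    (r r' k : ℕ) :
    newtonPowerSum X c (r + r') k = newtonPowerSum X a r k + newtonPowerSum X b r' k := by
  have hc' : c = evenConv a b := funext fun m ↦ by rw [hc m, evenConv_apply_eq_sum_cupEven]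
  have hc0 : c 0 = singularCohomology.one R X := by
    rw [hc', evenConv_apply, Finset.Nat.antidiagonal_zero, Finset.sum_singleton]
    change cupInto 0 0 0 (a 0) (b 0) = _
    rw [ha, cupInto_one_left, hb]
  -- `q(c) = q(a) + q(b)` by uniqueness
  have hq : signedPowerSum X c (r + r') = signedPowerSum X a r + signedPowerSum X b r' := by
    refine eq_of_evenConv_eq hc0 ?_
    rw [evenConv_signedPowerSum hc0, evenConv_add, hc', evenConv_comm a b, evenConv_assoc,
      evenConv_signedPowerSum ha, evenConv_comm b a, evenConv_assoc, evenConv_signedPowerSum hb,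
      euler_evenConv, evenConv_comm (euler a) b]
  cases k with
  | zero => rw [newtonPowerSum_zero, newtonPowerSum_zero, newtonPowerSum_zero, add_smul]
  | succ k =>
    rw [newtonPowerSum_succ_eq_smul_signedPowerSum, newtonPowerSum_succ_eq_smul_signedPowerSum,
      newtonPowerSum_succ_eq_smul_signedPowerSum, hq, Pi.add_apply, smul_add]

end Algebra

/-! ### The Chern character is additive -/

namespace ChernClassTheory

variable (C : ChernClassTheory) {B : Type} [TopologicalSpace B] [T2Space B] [ParacompactSpace B]

/-- **The power sums of the Chern classes are additive under Whitney sum**: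
`s_k(ξ ⊕ η) = s_k(ξ) + s_k(η)` ((C₂) `c(ξ ⊕ η) = c(ξ) c(η)` and (C₀) `c₀ = 1`, with Newton's
recursion; `s₀ = rank` is additive by `rank_directSum`). [cite: Hirzebruch1966, §10.1]
[cite: HusemollerFibreBundles1994, Ch. 17 §3 (C₂)] -/
theorem chernPowerSum_directSum (E₁ E₂ : ComplexVectorBundle.{0, 0} B) (k : ℕ) :
    C.chernPowerSum (E₁.directSum E₂) k = C.chernPowerSum E₁ k + C.chernPowerSum E₂ k := by
  rw [chernPowerSum, chernPowerSum, chernPowerSum, ComplexVectorBundle.rank_directSum]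
  exact newtonPowerSum_whitney _ _ _ (C.chernClass_zero E₁) (C.chernClass_zero E₂)
    (C.chernClass_directSum E₁ E₂) _ _ k

/-- **The topological Chern character is additive under Whitney sum**:
`ch_k(ξ ⊕ η) = ch_k(ξ) + ch_k(η)` ("`ch(ξ ⊕ η) = ch(ξ) + ch(η)`", Hirzebruch §10.1; Husemoller
Ch. 20 §8), over paracompact Hausdorff bases. [cite: Hirzebruch1966, §10.1]
[cite: HusemollerFibreBundles1994, Ch. 20 §8] -/
theorem topologicalChernCharacter_directSum (K : Type) [Field K] [CharZero K]
    (E₁ E₂ : ComplexVectorBundle.{0, 0} B) (k : ℕ) :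
    C.topologicalChernCharacter K (E₁.directSum E₂) k =
      C.topologicalChernCharacter K E₁ k + C.topologicalChernCharacter K E₂ k := by
  rw [topologicalChernCharacter, topologicalChernCharacter, topologicalChernCharacter,
    C.chernPowerSum_directSum, map_add, smul_add]

end ChernClassTheory

end Literature.AlgebraicTopology.CharacteristicClasses

end
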